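import Summits.NavierStokesRegularity.FluidComputer.DesignSpectralRadius

/-!
# ReynoldsTrapdoor — the Reynolds axis of the renormalised level map: exit Reynolds numbers,
# the gain envelope and the trapdoor (FLUID COMPUTER cell, idea-1 gen 19; zero compute)

HONEST FRAMING: low prior, high value-of-information experiment on Tao's machine paradigm;
NOT a claim that NS blows up.

Sibling of `DesignSpectralRadius.lean` (same namespace `…FluidComputer.DesignSpectralRadius`; the two were ONE
staged file `HOME/pub-fluidc-idea-1/lean/DesignSpectralRadius.lean` v2 sha16 `527ee7f72c67a267`, split by the
filing seat `pub-fluidc-lit` gen 44 at the `## The Reynolds axis` section for the tree's 400-line limit —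
statements and proofs byte-identical; LEAN ASK #12, HOME/STATUS.md l.4665).  Dictionary: cell files
`pub-fluidc-idea-1/DESIGN-RADIUS.md`, `atlas/IDEA-1.md` §23, `PREREG-R2.md` §10bf (P-G19-1).

* REYNOLDS AXIS (`ReynoldsLaw`): on the PHYSICAL (un-reset) renormalised map the band Reynolds number obeys
  `Re(M w) = Re(w)·r(w)` exactly (`ℓ ↦ ℓ/λ`, `U ↦ g·U`, `ν` fixed), so `Re(Mⁿ v) = Re(v)·Π_{i<n} r_i`
  (`re_iterate`): a machine's Reynolds numbers never decrease (`re_mono_of_machine`), and under a monotone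
  GAIN ENVELOPE `gain w ≤ γ(Re w)` a seed starting below the TRAPDOOR `γ(R₀) < λ` stays below it with every
  level sub-floor (`trapdoor`), decaying geometrically if `γ(R₀) ≤ θλ`, `θ < 1` (`trapdoor_decay`,
  `trapdoor_tendsto_zero`); a machine needs `λ ≤ γ(Re(Mⁿ v))` at every level (`envelope_of_machine`).
  Cell reading (numbers of record, S6–S8 of `atlas/IDEA-1.md` §21): two measured envelope points
  `γ(Re₀) ≈ 3.21`, `γ(3Re₀) ≈ 3.84` (slope `d log γ/d log Re ≈ 0.16`); level-two EXIT Reynolds numbers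
  `Re₂/Re₀ = Q₂/λ² = 0.30` (row (a): `1.60 × 0.19`) and `0.49` (row (d)) sit far above the extrapolated
  trapdoor `R_c ≈ 0.06 Re₀`: the recorded depth-2 kill is by SHAPE (coherence), not by Reynolds starvation —
  the content of conditional pre-registration P-G19-1 (`PREREG-R2.md` §10bf).

`ReynoldsLaw` is a hypothesis bundle consumed as an explicit argument `(L : ReynoldsLaw Φ Re)`; nothing here
asserts it of any level map, and nothing about Navier–Stokes is claimed.  0 sorry; elementary.
-/

noncomputable section

open Filter Topology Function Finset

namespace Summit.NavierStokesRegularity.FluidComputer.DesignSpectralRadius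

open RGFixedPoint

variable {X : Type*} {Φ : LevelMap X}

/-! ## The Reynolds axis: exit Reynolds numbers, the envelope and the trapdoor -/

/-- A REYNOLDS LAW for the (physical, un-reset) renormalised level map: a non-negative size functional `Re`
(the band Reynolds number `U ℓ/ν` of the state) multiplying by the level ratio at each step,
`Re(M w) = Re(w)·(gain w/λ)` — exact bookkeeping of `ℓ ↦ ℓ/λ`, `U ↦ gain·U`, `ν` fixed.  A hypothesis bundle,
consumed as `(L : ReynoldsLaw Φ Re)`; nothing in this file asserts it of any level map. [folklore] -/
structure ReynoldsLaw (Φ : LevelMap X) (Re : X → ℝ) : Prop where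
  /-- one level multiplies the Reynolds number by the level ratio -/
  step : ∀ w, Re (Φ.M w) = Re w * (Φ.gain w / Φ.lam)
  /-- Reynolds numbers are non-negative -/
  nonneg : ∀ w, 0 ≤ Re w

namespace ReynoldsLaw

variable {Re : X → ℝ}

/-- Under a gain ENVELOPE `gain w ≤ γ(Re w)`, a machine needs `λ ≤ γ(Re(Mⁿ v))` at every level
(the envelope at the running Reynolds number must never drop below `λ`). -/
theorem envelope_of_machine {γ : ℝ → ℝ} (henv : ∀ w, Φ.gain w ≤ γ (Re w)) {v : X}
    (hmach : ∀ n, 1 ≤ Φ.levelRatio v n) (n : ℕ) : Φ.lam ≤ γ (Re (Φ.M^[n] v)) :=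
  ((one_le_levelRatio_iff Φ).mp (hmach n)).trans (henv _)

variable (L : ReynoldsLaw Φ Re)
include L

/-- One step along the orbit: `Re_{n+1} = Re_n · r_n`. -/
theorem re_succ (v : X) (n : ℕ) :
    Re (Φ.M^[n + 1] v) = Re (Φ.M^[n] v) * Φ.levelRatio v n := by
  rw [iterate_succ_apply']
  exact L.step _

/-- **Exit Reynolds number of a window**: `Re(Mⁿ v) = Re(v) · Π_{i<n} r_i`. -/
theorem re_iterate (v : X) (n : ℕ) :
    Re (Φ.M^[n] v) = Re v * ∏ i ∈ range n, Φ.levelRatio v i := by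
  induction n with
  | zero => simp
  | succ n ih => rw [L.re_succ, ih, prod_range_succ, mul_assoc]

/-- A machine's Reynolds numbers never decrease along the cascade. -/
theorem re_mono_of_machine {v : X} (hmach : ∀ n, 1 ≤ Φ.levelRatio v n) :
    Monotone fun n => Re (Φ.M^[n] v) := by
  refine monotone_nat_of_le_succ fun n => ?_
  show Re (Φ.M^[n] v) ≤ Re (Φ.M^[n + 1] v)
  rw [L.re_succ]
  exact le_mul_of_one_le_right (L.nonneg _) (hmach n)

/-- **Trapdoor.**  With a MONOTONE envelope `γ` and a Reynolds number `R₀` at which `γ(R₀) < λ`, a seed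
with `Re v ≤ R₀` stays below `R₀` for ever and EVERY level of its ladder is sub-floor. -/
theorem trapdoor {γ : ℝ → ℝ} (hγ : Monotone γ) (henv : ∀ w, Φ.gain w ≤ γ (Re w)) {R₀ : ℝ}
    (hR : γ R₀ < Φ.lam) {v : X} (hv : Re v ≤ R₀) (n : ℕ) :
    Re (Φ.M^[n] v) ≤ R₀ ∧ Φ.levelRatio v n < 1 := by
  have key : ∀ m, Re (Φ.M^[m] v) ≤ R₀ → Φ.levelRatio v m < 1 := fun m hm =>
    (levelRatio_lt_one_iff Φ).mpr (lt_of_le_of_lt ((henv _).trans (hγ hm)) hR)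
  suffices h : Re (Φ.M^[n] v) ≤ R₀ from ⟨h, key n h⟩
  induction n with
  | zero => simpa using hv
  | succ n ih =>
      rw [L.re_succ]
      exact (mul_le_of_le_one_right (L.nonneg _) (key n ih).le).trans ih

/-- **Geometric decay below the trapdoor**: if moreover `γ(R₀) ≤ θ·λ` with `0 ≤ θ ≤ 1`, then
`Re(Mⁿ v) ≤ R₀·θⁿ`. -/
theorem trapdoor_decay {γ : ℝ → ℝ} (hγ : Monotone γ) (henv : ∀ w, Φ.gain w ≤ γ (Re w)) {R₀ θ : ℝ}
    (hθ0 : 0 ≤ θ) (hθ1 : θ ≤ 1) (hR : γ R₀ ≤ θ * Φ.lam) {v : X} (hv : Re v ≤ R₀) (n : ℕ) :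
    Re (Φ.M^[n] v) ≤ R₀ * θ ^ n := by
  -- every level ratio is at most θ as long as Re ≤ R₀, and Re stays ≤ R₀
  have stay : ∀ m, Re (Φ.M^[m] v) ≤ R₀ := by
    intro m
    induction m with
    | zero => simpa using hv
    | succ m ih =>
        rw [L.re_succ]
        have hr : Φ.levelRatio v m ≤ 1 := by
          show Φ.levelGain v m / Φ.lam ≤ 1
          rw [div_le_iff₀ Φ.lam_pos, one_mul]
          exact (henv _).trans ((hγ ih).trans (hR.trans (mul_le_of_le_one_left Φ.lam_pos.le hθ1)))
        exact (mul_le_of_le_one_right (L.nonneg _) hr).trans ih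
  have ratio : ∀ m, Φ.levelRatio v m ≤ θ := by
    intro m
    show Φ.levelGain v m / Φ.lam ≤ θ
    rw [div_le_iff₀ Φ.lam_pos]
    exact (henv _).trans ((hγ (stay m)).trans hR)
  induction n with
  | zero => simpa using hv
  | succ n ih =>
      rw [L.re_succ, pow_succ, ← mul_assoc]
      exact (mul_le_mul_of_nonneg_left (ratio n) (L.nonneg _)).trans
        (mul_le_mul_of_nonneg_right ih hθ0)

/-- … hence `Re(Mⁿ v) → 0` when `θ < 1`: the regular branch — the cascade starves geometrically. -/
theorem trapdoor_tendsto_zero {γ : ℝ → ℝ} (hγ : Monotone γ) (henv : ∀ w, Φ.gain w ≤ γ (Re w))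
    {R₀ θ : ℝ} (hθ0 : 0 ≤ θ) (hθ1 : θ < 1) (hR : γ R₀ ≤ θ * Φ.lam) {v : X} (hv : Re v ≤ R₀) :
    Tendsto (fun n => Re (Φ.M^[n] v)) atTop (𝓝 0) := by
  refine squeeze_zero (fun n => L.nonneg _) (fun n => L.trapdoor_decay hγ henv hθ0 hθ1.le hR hv n) ?_
  simpa using (tendsto_pow_atTop_nhds_zero_of_lt_one hθ0 hθ1).const_mul R₀

end ReynoldsLaw

end Summit.NavierStokesRegularity.FluidComputer.DesignSpectralRadius
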